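import Literature.NumberTheory.LFunctions.ZeroDensityInghamTools
import Mathlib.Analysis.SpecialFunctions.Arsinh
import Mathlib.MeasureTheory.Integral.IntegralEqImproper
import HarnessLib

/-!
# Ivić 1985, Theorem 11.3 — tools (unit I3, node T): the `log(1/η)` bound for the Riesz kernel

NOT RH-BEARING (D-0040; bears_on LADDER-RH §4 HELD `DensityLadder`, stmt-19600): kernel bookkeeping
for a zero-density argument, which COUNTS zeros off the critical line and never empties the strip
(`Literature.Barriers.RiemannHypothesis.LindelofBacklund`); corpus theorems are RH-FREE literature
and nothing in this file is worded as progress toward RH.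

Topic `NumberTheory/LFunctions`; corpus C4 (rh-crit/gm), unit I3 = the discharge of the named fact
`Literature.NumberTheory.LFunctions.Ivic1985_theorem11_3` (Ivić 1985, Theorem 11.3 (11.32) AS
PRINTED), node **T** of `gm/I3-CENSUS.md`. In Ivić's proof (p. 280, (11.45) ⇒ (11.49)) the
class-`R₂` zeros yield a large value of the mollifier `M_X` after dividing the zero-detecting
integral by `M(α, 2T) · ∫ |Γ(α − β + iv)| dv`; Ivić budgets a full `log T` for the kernel integral
("we may suppose first that `σ < 1 − C/log T`"). On the tree's Riesz-kernel framework
(`ZetaZeroDetection.lean`, `ZeroDensityNearOneDetection.lean`: `K(w) = 2/(w(w+1)(w+2))` in place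
of `Γ`) the true size of `∫ ‖K(-η+iy)‖ dy` is `O(1 + log(1/η))`, which is what the class-II count
of unit I3 consumes (the tree's `ZeroDensity.integral_norm_rieszK_le`, `≤ 2π/η₀²`, is too lossy
there). Everything below is PROVED; no definition, no named fact.

* `ZeroDensity.norm_rieszK_neg_line_le_inv_sqrt` — `‖K(-η+iy)‖ ≤ (8/3)/√(η²+y²)` (`0 < η ≤ 1/2`);
* `ZeroDensity.norm_rieszK_neg_line_le_inv_cube` — `‖K(-η+iy)‖ ≤ 2/|y|³` (`y ≠ 0`, any real `η`);
* (private) `arsinh_le_one_add_log`, `integral_inv_sqrt_sq_add_sq`, `integral_two_div_cube` —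
  calculus helpers;
* `ZeroDensity.integral_norm_rieszK_unit_le_log` — `∫_{-1}^{1} ‖K(-η+iy)‖ dy ≤ (16/3)(1 + log(1/η))`;
* `ZeroDensity.integral_norm_rieszK_tail_le` — `∫_1^T ‖K‖ ≤ 1`, `∫_{-T}^{-1} ‖K‖ ≤ 1` (`T ≥ 1`);
* `ZeroDensity.integral_norm_rieszK_le_log` — `∫_{-T}^{T} ‖K(-η+iy)‖ dy ≤ 8 + 6 log(1/η)`
  for every `T ≥ 0`, `0 < η ≤ 1/2`;
* `ZeroDensity.integrable_norm_rieszK_neg_line`, `ZeroDensity.integral_norm_rieszK_le_log_real` —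
  the same over `ℝ` (SIG-T (i) of `gm/I3-CENSUS.md`).

## References

* A. Ivić, *The Riemann Zeta-Function. The Theory of the Riemann Zeta-Function with
  Applications*, Wiley 1985 (Dover 2003), §11.4, proof of Theorem 11.3, (11.45) and the paragraph
  before (11.49), p. 280 (held copy `book:ivic1985-riemann-zeta-function-theory-riemann-zeta-function`,
  chunk p0215). [key `Ivic1985`]
* E. C. Titchmarsh, *The Theory of the Riemann Zeta-Function*, 2nd ed. (1986), §9.16 (the
  mollifier / Riesz-mean set-up). [key `Titchmarsh1986`]
-/

noncomputable section

open Complex Real MeasureTheory intervalIntegral Set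

namespace Literature.NumberTheory.LFunctions

namespace ZeroDensity

/-- The point `-η + iy` and the three factors of `K`: norms. [folklore] -/
private lemma norm_line_pt (η y : ℝ) : ‖(((-η : ℝ) : ℂ) + y * I)‖ = Real.sqrt (η ^ 2 + y ^ 2) := by
  rw [Complex.norm_def, Complex.normSq_apply]
  congr 1
  simp; ring

/-- Real part of `(-η + iy) + j`. [folklore] -/
private lemma re_line_pt_add (η y j : ℝ) : ((((-η : ℝ) : ℂ) + y * I) + j).re = j - η := by
  simp; ring

/-- Imaginary part of `(-η + iy) + j`. [folklore] -/
private lemma im_line_pt_add (η y j : ℝ) : ((((-η : ℝ) : ℂ) + y * I) + j).im = y := by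
  simp

/-- `‖K(-η + iy)‖ ≤ (8/3)/√(η² + y²)` for `0 < η ≤ 1/2`: `|z+1| ≥ 1/2`, `|z+2| ≥ 3/2`,
`|z| = √(η²+y²)`, `K = 2/(z(z+1)(z+2))`. [cite: Ivic1985, §11.4, proof of Theorem 11.3, (11.45)–(11.49), p. 280 (kernel integral); Titchmarsh1986, §9.16 (Riesz mean)]  -/
theorem norm_rieszK_neg_line_le_inv_sqrt {η : ℝ} (h0 : 0 < η) (h2 : η ≤ 1 / 2) (y : ℝ) :
    ‖ZeroDetect.rieszK (((-η : ℝ) : ℂ) + y * I)‖ ≤ 8 / 3 / Real.sqrt (η ^ 2 + y ^ 2) := by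
  set z : ℂ := ((-η : ℝ) : ℂ) + y * I with hz
  have hs0 : 0 < Real.sqrt (η ^ 2 + y ^ 2) := Real.sqrt_pos.mpr (by positivity)
  have hz0 : ‖z‖ = Real.sqrt (η ^ 2 + y ^ 2) := norm_line_pt η y
  have hz1 : (1 : ℝ) / 2 ≤ ‖z + 1‖ := by
    have h := Complex.abs_re_le_norm (z + 1)
    have hre : (z + 1).re = 1 - η := by rw [hz]; exact_mod_cast re_line_pt_add η y 1
    rw [hre, abs_of_pos (by linarith)] at h
    linarith
  have hz2 : (3 : ℝ) / 2 ≤ ‖z + 2‖ := by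
    have h := Complex.abs_re_le_norm (z + 2)
    have hre : (z + 2).re = 2 - η := by rw [hz]; exact_mod_cast re_line_pt_add η y 2
    rw [hre, abs_of_pos (by linarith)] at h
    linarith
  have hne0 : z ≠ 0 := norm_pos_iff.mp (by rw [hz0]; exact hs0)
  have hne1 : z + 1 ≠ 0 := norm_pos_iff.mp (by linarith)
  have hne2 : z + 2 ≠ 0 := norm_pos_iff.mp (by linarith)
  have hK : ZeroDetect.rieszK z = 2 / (z * (z + 1) * (z + 2)) := by
    simp only [ZeroDetect.rieszK]
    exact RieszPerron.Kfun_eq hne0 hne1 hne2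
  rw [hK, norm_div, Complex.norm_ofNat, norm_mul, norm_mul, hz0]
  rw [div_le_div_iff₀ (by positivity) hs0]
  have h34 : Real.sqrt (η ^ 2 + y ^ 2) * (3 / 4) ≤ Real.sqrt (η ^ 2 + y ^ 2) * ‖z + 1‖ * ‖z + 2‖ := by
    have h := mul_le_mul hz1 hz2 (by norm_num) (norm_nonneg _)
    calc Real.sqrt (η ^ 2 + y ^ 2) * (3 / 4) = Real.sqrt (η ^ 2 + y ^ 2) * (1 / 2 * (3 / 2)) := by
          ring
      _ ≤ Real.sqrt (η ^ 2 + y ^ 2) * (‖z + 1‖ * ‖z + 2‖) :=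
          mul_le_mul_of_nonneg_left h hs0.le
      _ = _ := by ring
  nlinarith

/-- `‖K(-η + iy)‖ ≤ 2/|y|³` for `y ≠ 0` (each factor has modulus `≥ |y|`). [cite: Ivic1985, §11.4, proof of Theorem 11.3, (11.45)–(11.49), p. 280 (kernel integral); Titchmarsh1986, §9.16 (Riesz mean)]  -/
theorem norm_rieszK_neg_line_le_inv_cube (η : ℝ) {y : ℝ} (hy : y ≠ 0) : ‖ZeroDetect.rieszK (((-η : ℝ) : ℂ) + y * I)‖ ≤ 2 / |y| ^ 3 := by
  set z : ℂ := ((-η : ℝ) : ℂ) + y * I with hz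
  have hy0 : 0 < |y| := abs_pos.mpr hy
  have him : ∀ j : ℝ, |y| ≤ ‖z + j‖ := by
    intro j
    have h := Complex.abs_im_le_norm (z + j)
    have : (z + j).im = y := by rw [hz]; exact im_line_pt_add η y j
    rwa [this] at h
  have hz0 : |y| ≤ ‖z‖ := by simpa using him 0
  have hz1 : |y| ≤ ‖z + 1‖ := by exact_mod_cast him 1
  have hz2 : |y| ≤ ‖z + 2‖ := by exact_mod_cast him 2
  have hne0 : z ≠ 0 := norm_pos_iff.mp (hy0.trans_le hz0)
  have hne1 : z + 1 ≠ 0 := norm_pos_iff.mp (hy0.trans_le hz1)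
  have hne2 : z + 2 ≠ 0 := norm_pos_iff.mp (hy0.trans_le hz2)
  have hK : ZeroDetect.rieszK z = 2 / (z * (z + 1) * (z + 2)) := by
    simp only [ZeroDetect.rieszK]
    exact RieszPerron.Kfun_eq hne0 hne1 hne2
  rw [hK, norm_div, Complex.norm_ofNat, norm_mul, norm_mul]
  rw [div_le_div_iff₀ (by positivity) (by positivity)]
  have h3 : |y| ^ 3 ≤ ‖z‖ * ‖z + 1‖ * ‖z + 2‖ := by
    have h := mul_le_mul hz0 hz1 hy0.le (norm_nonneg _)
    have h' := mul_le_mul h hz2 hy0.le (by positivity)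
    calc |y| ^ 3 = |y| * |y| * |y| := by ring
      _ ≤ _ := h'
  nlinarith

/-- Continuity of `y ↦ ‖K(-η+iy)‖` packaged as interval integrability. [folklore] -/
private lemma intInt_norm_rieszK {η : ℝ} (h0 : 0 < η) (h2 : η ≤ 1 / 2) (a b : ℝ) :
    IntervalIntegrable (fun y : ℝ ↦ ‖ZeroDetect.rieszK (((-η : ℝ) : ℂ) + y * I)‖) volume a b :=
  (continuous_norm_rieszK_neg_line h0 h2).intervalIntegrable _ _

/-- `arsinh x ≤ 1 + log x` for `x ≥ 1` (`x + √(1+x²) ≤ (1+√2)x ≤ e·x`). [folklore] -/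
private theorem arsinh_le_one_add_log {x : ℝ} (hx : 1 ≤ x) : Real.arsinh x ≤ 1 + Real.log x := by
  have hx0 : 0 < x := by linarith
  rw [Real.arsinh]
  have hs : Real.sqrt (1 + x ^ 2) ≤ x + 1 / (2 * x) := by
    rw [Real.sqrt_le_left (by positivity)]
    have e : (x + 1 / (2 * x)) ^ 2 = 1 + x ^ 2 + 1 / (4 * x ^ 2) := by
      field_simp
      ring
    rw [e]
    have : 0 ≤ 1 / (4 * x ^ 2) := by positivity
    linarith
  have hx2 : 1 / (2 * x) ≤ x / 2 := by
    rw [div_le_div_iff₀ (by positivity) (by norm_num)]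
    nlinarith
  have he : (5 : ℝ) / 2 ≤ Real.exp 1 := by
    have h2 := Real.exp_one_gt_d9
    linarith
  have hsum : x + Real.sqrt (1 + x ^ 2) ≤ Real.exp 1 * x := by nlinarith
  have hpos : 0 < x + Real.sqrt (1 + x ^ 2) := by positivity
  calc Real.log (x + Real.sqrt (1 + x ^ 2)) ≤ Real.log (Real.exp 1 * x) :=
        Real.log_le_log hpos hsum
    _ = 1 + Real.log x := by rw [Real.log_mul (Real.exp_pos 1).ne' hx0.ne', Real.log_exp]

/-- `∫_{-1}^{1} dy/√(η²+y²) = 2 arsinh(1/η)` (`η > 0`). [folklore] -/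
private theorem integral_inv_sqrt_sq_add_sq {η : ℝ} (h0 : 0 < η) :
    ∫ y in (-1 : ℝ)..1, (Real.sqrt (η ^ 2 + y ^ 2))⁻¹ = 2 * Real.arsinh (1 / η) := by
  have hderiv : ∀ y ∈ uIcc (-1 : ℝ) 1,
      HasDerivAt (fun y : ℝ ↦ Real.arsinh (y / η)) ((Real.sqrt (η ^ 2 + y ^ 2))⁻¹) y := by
    intro y _
    have h1 : HasDerivAt (fun y : ℝ ↦ y / η) (1 / η) y := by
      simpa using (hasDerivAt_id y).div_const η
    have h := (Real.hasDerivAt_arsinh (y / η)).comp y h1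
    have he : (Real.sqrt (1 + (y / η) ^ 2))⁻¹ * (1 / η) = (Real.sqrt (η ^ 2 + y ^ 2))⁻¹ := by
      have h1 : (1 + (y / η) ^ 2) * η ^ 2 = η ^ 2 + y ^ 2 := by
        rw [div_pow, add_mul, one_mul, div_mul_cancel₀ _ (pow_ne_zero 2 h0.ne')]
      have h2 : Real.sqrt (η ^ 2 + y ^ 2) = Real.sqrt (1 + (y / η) ^ 2) * η := by
        rw [← h1, Real.sqrt_mul (by positivity) (η ^ 2), Real.sqrt_sq h0.le]
      rw [h2, mul_inv, one_div]
    rw [he] at h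
    exact h
  have hint : IntervalIntegrable (fun y : ℝ ↦ (Real.sqrt (η ^ 2 + y ^ 2))⁻¹) volume (-1) 1 := by
    refine Continuous.intervalIntegrable ?_ _ _
    refine Continuous.inv₀ (by fun_prop) fun y ↦ (Real.sqrt_pos.mpr (by positivity)).ne'
  rw [integral_eq_sub_of_hasDerivAt hderiv hint]
  rw [show ((-1 : ℝ) / η) = -(1 / η) by ring, Real.arsinh_neg]
  ring

/-- **Unit window**: `∫_{-1}^{1} ‖K(-η+iy)‖ dy ≤ (16/3)(1 + log(1/η))` for `0 < η ≤ 1/2`. [cite: Ivic1985, §11.4, proof of Theorem 11.3, (11.45)–(11.49), p. 280 (kernel integral); Titchmarsh1986, §9.16 (Riesz mean)]  -/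
theorem integral_norm_rieszK_unit_le_log {η : ℝ} (h0 : 0 < η) (h2 : η ≤ 1 / 2) :
    ∫ y in (-1 : ℝ)..1, ‖ZeroDetect.rieszK (((-η : ℝ) : ℂ) + y * I)‖ ≤
      16 / 3 * (1 + Real.log (1 / η)) := by
  have hcont : Continuous fun y : ℝ ↦ (Real.sqrt (η ^ 2 + y ^ 2))⁻¹ :=
    Continuous.inv₀ (by fun_prop) fun y ↦ (Real.sqrt_pos.mpr (by positivity)).ne'
  calc ∫ y in (-1 : ℝ)..1, ‖ZeroDetect.rieszK (((-η : ℝ) : ℂ) + y * I)‖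
      ≤ ∫ y in (-1 : ℝ)..1, 8 / 3 * (Real.sqrt (η ^ 2 + y ^ 2))⁻¹ := by
        refine integral_mono_on (by norm_num) (intInt_norm_rieszK h0 h2 _ _)
          ((continuous_const.mul hcont).intervalIntegrable _ _) fun y _ ↦ ?_
        rw [← div_eq_mul_inv]
        exact norm_rieszK_neg_line_le_inv_sqrt h0 h2 y
    _ = 8 / 3 * (2 * Real.arsinh (1 / η)) := by
        rw [intervalIntegral.integral_const_mul, integral_inv_sqrt_sq_add_sq h0]
    _ ≤ 8 / 3 * (2 * (1 + Real.log (1 / η))) := by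
        have h1 : (1 : ℝ) ≤ 1 / η := by rw [le_div_iff₀ h0]; linarith
        have := arsinh_le_one_add_log h1
        nlinarith
    _ = 16 / 3 * (1 + Real.log (1 / η)) := by ring

/-- `∫_1^T 2/y³ dy = 1 − 1/T²` for `T ≥ 1`. [folklore] -/
private theorem integral_two_div_cube {T : ℝ} (hT : 1 ≤ T) :
    ∫ y in (1 : ℝ)..T, 2 / y ^ 3 = 1 - (T ^ 2)⁻¹ := by
  have h0mem : (0 : ℝ) ∉ uIcc (1 : ℝ) T := by
    rw [uIcc_of_le hT]; intro h; linarith [h.1]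
  have hcongr : ∫ y in (1 : ℝ)..T, 2 / y ^ 3 = ∫ y in (1 : ℝ)..T, 2 * y ^ (-3 : ℤ) := by
    refine integral_congr fun y _ ↦ ?_
    simp only [div_eq_mul_inv, zpow_neg, zpow_ofNat]
  rw [hcongr, intervalIntegral.integral_const_mul, integral_zpow (Or.inr ⟨by norm_num, h0mem⟩)]
  have hT0 : T ≠ 0 := by linarith
  rw [show (-3 : ℤ) + 1 = -2 by norm_num, one_zpow, zpow_neg, zpow_ofNat]
  push_cast
  ring

/-- Tail pieces: `∫_{1}^{T} ‖K(-η+iy)‖ dy ≤ 1` and `∫_{-T}^{-1} ‖K(-η+iy)‖ dy ≤ 1` for `T ≥ 1`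
(`‖K‖ ≤ 2/|y|³`, `∫_1^T 2/y³ = 1 − 1/T²`). [cite: Ivic1985, §11.4, proof of Theorem 11.3, (11.45)–(11.49), p. 280 (kernel integral); Titchmarsh1986, §9.16 (Riesz mean)]  -/
theorem integral_norm_rieszK_tail_le {η : ℝ} (h0 : 0 < η) (h2 : η ≤ 1 / 2) {T : ℝ} (hT : 1 ≤ T) :
    ∫ y in (1 : ℝ)..T, ‖ZeroDetect.rieszK (((-η : ℝ) : ℂ) + y * I)‖ ≤ 1 ∧
    ∫ y in (-T)..(-1 : ℝ), ‖ZeroDetect.rieszK (((-η : ℝ) : ℂ) + y * I)‖ ≤ 1 := by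
  have hI := integral_two_div_cube hT
  have hTi : 0 ≤ (T ^ 2)⁻¹ := by positivity
  have hcontI : ContinuousOn (fun y : ℝ ↦ 2 / y ^ 3) (uIcc (1 : ℝ) T) := by
    rw [uIcc_of_le hT]
    exact ContinuousOn.div continuousOn_const (by fun_prop) fun y hy ↦ by
      have : 0 < y := by linarith [hy.1]
      positivity
  constructor
  · calc ∫ y in (1 : ℝ)..T, ‖ZeroDetect.rieszK (((-η : ℝ) : ℂ) + y * I)‖
        ≤ ∫ y in (1 : ℝ)..T, 2 / y ^ 3 := by
          refine integral_mono_on hT (intInt_norm_rieszK h0 h2 _ _) hcontI.intervalIntegrable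
            fun y hy ↦ ?_
          have hy0 : 0 < y := by linarith [hy.1]
          have h := norm_rieszK_neg_line_le_inv_cube η hy0.ne'
          rwa [abs_of_pos hy0] at h
      _ = 1 - (T ^ 2)⁻¹ := hI
      _ ≤ 1 := by linarith
  · have hT' : -T ≤ -1 := by linarith
    have hcontI' : ContinuousOn (fun y : ℝ ↦ 2 / (-y) ^ 3) (uIcc (-T) (-1 : ℝ)) := by
      rw [uIcc_of_le hT']
      exact ContinuousOn.div continuousOn_const (by fun_prop) fun y hy ↦ by
        have : 0 < -y := by linarith [hy.2]
        positivity
    calc ∫ y in (-T)..(-1 : ℝ), ‖ZeroDetect.rieszK (((-η : ℝ) : ℂ) + y * I)‖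
        ≤ ∫ y in (-T)..(-1 : ℝ), 2 / (-y) ^ 3 := by
          refine integral_mono_on hT' (intInt_norm_rieszK h0 h2 _ _) hcontI'.intervalIntegrable
            fun y hy ↦ ?_
          have hy0 : y < 0 := by linarith [hy.2]
          have h := norm_rieszK_neg_line_le_inv_cube η hy0.ne
          rwa [abs_of_neg hy0] at h
      _ = ∫ y in (1 : ℝ)..T, 2 / y ^ 3 := by
          rw [intervalIntegral.integral_comp_neg (fun y : ℝ ↦ 2 / y ^ 3)]
          simp
      _ = 1 - (T ^ 2)⁻¹ := hI
      _ ≤ 1 := by linarith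

/-- **The `log(1/η)` bound**: for `0 < η ≤ 1/2` and every `T ≥ 0`,
`∫_{-T}^{T} ‖K(-η+iy)‖ dy ≤ 8 + 6 log(1/η)` (in place of the tree's `2π/η²`,
`ZeroDensity.integral_norm_rieszK_le`). [cite: Ivic1985, §11.4, proof of Theorem 11.3, (11.45)–(11.49), p. 280 (kernel integral); Titchmarsh1986, §9.16 (Riesz mean)]  -/
theorem integral_norm_rieszK_le_log {η : ℝ} (h0 : 0 < η) (h2 : η ≤ 1 / 2) {T : ℝ} (hT : 0 ≤ T) :
    ∫ y in (-T)..T, ‖ZeroDetect.rieszK (((-η : ℝ) : ℂ) + y * I)‖ ≤ 8 + 6 * Real.log (1 / η) := by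
  have hlog0 : 0 ≤ Real.log (1 / η) := Real.log_nonneg (by rw [le_div_iff₀ h0]; linarith)
  have hunit := integral_norm_rieszK_unit_le_log h0 h2
  rcases le_or_gt T 1 with hT1 | hT1
  · -- small window: monotonicity in the interval
    calc ∫ y in (-T)..T, ‖ZeroDetect.rieszK (((-η : ℝ) : ℂ) + y * I)‖
        ≤ ∫ y in (-1 : ℝ)..1, ‖ZeroDetect.rieszK (((-η : ℝ) : ℂ) + y * I)‖ := by
          refine integral_mono_interval (by linarith) (by linarith) hT1
            (Filter.Eventually.of_forall fun y ↦ norm_nonneg _) (intInt_norm_rieszK h0 h2 _ _)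
      _ ≤ 16 / 3 * (1 + Real.log (1 / η)) := hunit
      _ ≤ 8 + 6 * Real.log (1 / η) := by linarith
  · obtain ⟨ht1, ht2⟩ := integral_norm_rieszK_tail_le h0 h2 hT1.le
    have hsplit : ∫ y in (-T)..T, ‖ZeroDetect.rieszK (((-η : ℝ) : ℂ) + y * I)‖ =
        (∫ y in (-T)..(-1 : ℝ), ‖ZeroDetect.rieszK (((-η : ℝ) : ℂ) + y * I)‖) +
        ((∫ y in (-1 : ℝ)..1, ‖ZeroDetect.rieszK (((-η : ℝ) : ℂ) + y * I)‖) +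
          ∫ y in (1 : ℝ)..T, ‖ZeroDetect.rieszK (((-η : ℝ) : ℂ) + y * I)‖) := by
      rw [integral_add_adjacent_intervals (intInt_norm_rieszK h0 h2 _ _)
        (intInt_norm_rieszK h0 h2 _ _),
        integral_add_adjacent_intervals (intInt_norm_rieszK h0 h2 _ _)
        (intInt_norm_rieszK h0 h2 _ _)]
    rw [hsplit]
    linarith

/-- Integrability of `y ↦ ‖K(-η+iy)‖` on `ℝ` (`0 < η ≤ 1/2`). [cite: Ivic1985, §11.4, proof of Theorem 11.3, (11.45)–(11.49), p. 280 (kernel integral); Titchmarsh1986, §9.16 (Riesz mean)]  -/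
theorem integrable_norm_rieszK_neg_line {η : ℝ} (h0 : 0 < η) (h2 : η ≤ 1 / 2) :
    Integrable fun y : ℝ ↦ ‖ZeroDetect.rieszK (((-η : ℝ) : ℂ) + y * I)‖ := by
  have h := (RieszPerron.integrable_Kfun_line (σ := -η) (m := η) h0
    (by rw [abs_neg, abs_of_pos h0])
    (by rw [abs_of_pos (by linarith)]; linarith)
    (by rw [abs_of_pos (by linarith)]; linarith)).norm
  simpa [ZeroDetect.rieszK] using h

/-- **The `log(1/η)` bound on the whole line** (the shape of gm/I3-CENSUS.md SIG-T (i)):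
`∫_ℝ ‖K(-η+iy)‖ dy ≤ 8 + 6 log(1/η)` for `0 < η ≤ 1/2`. [cite: Ivic1985, §11.4, proof of Theorem 11.3, (11.45)–(11.49), p. 280 (kernel integral); Titchmarsh1986, §9.16 (Riesz mean)]  -/
theorem integral_norm_rieszK_le_log_real {η : ℝ} (h0 : 0 < η) (h2 : η ≤ 1 / 2) :
    ∫ y : ℝ, ‖ZeroDetect.rieszK (((-η : ℝ) : ℂ) + y * I)‖ ≤ 8 + 6 * Real.log (1 / η) := by
  have hint := integrable_norm_rieszK_neg_line h0 h2
  have hlim := MeasureTheory.intervalIntegral_tendsto_integral hint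
    (Filter.tendsto_neg_atTop_atBot) Filter.tendsto_id
  refine le_of_tendsto hlim ?_
  filter_upwards [Filter.eventually_ge_atTop (0 : ℝ)] with T hT
  exact integral_norm_rieszK_le_log h0 h2 hT

end ZeroDensity

end Literature.NumberTheory.LFunctions
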